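import Summits.RiemannHypothesis.RiemannHypothesis.Theorems.SpectralTraceSpectralThesisStubDensityAux
import Literature.NumberTheory.LFunctions.WeilMellinInversion
import Literature.NumberTheory.LFunctions.RiemannSiegelFacts
import Literature.NumberTheory.LFunctions.RiemannSiegelThetaBounds
import HarnessLib

/-!
# Crux `SpectralThesis` (stmt-RiemannHypothesis-0187), line `Sketch` — stub `stub_density`, estimates

Three ingredients of `stub_density` (`Theorems/SpectralTraceSpectralThesisStubDensity.lean`):

* `log_smoothing` — for `|K(u)| ≤ C/(1+u²)`:
  `|∫ K(u)(log(a² + (v−u)²) − log(1+v²)) du| ≤ M` uniformly in `0 < a ≤ 1`, `v ∈ ℝ`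
  (pointwise `|…| ≤ 2 log 2 + log(1+u²) + max(0, −log(v−u)²)` off `u = v`);
* `integral_mul_conv_swap` — the Fubini step `∫ ĝ (q ∗ w) = ∫ (q ∗ ĝ) w` for an even kernel
  `|q(x)| ≤ AC/(1+(Ax)²)` and a weight of log growth (Peetre's inequality);
* `weil_value` — `∫ ĝ (θ'/π + K_c) = W(g)` for `tsupport g ⊆ [-A, A]`, `A ≤ 1/2`: the prime term
  vanishes (`weilPrimeTerm_eq_zero_of_tsupport_subset`), `∫ ĝ K_c = ∫ g σ_c = ĝ(0) + ĝ(1)`, and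
  `(1/π)∫ ĝ θ' = weilArchTerm g` by `Re ψ(1/4+it/2) = 2θ' + log π`, `∫ ĝ = 2π g(0)`
  (`integral_weilMellin_vertical`).
-/

noncomputable section

set_option linter.dupNamespace false
set_option autoImplicit false

open Complex Set MeasureTheory Filter
open scoped Real ContDiff Topology

namespace Summit.RiemannHypothesis.RiemannHypothesis.Theorems.SpectralThesis.Sketch

open Literature.NumberTheory.LFunctions

namespace Density

/-- **The log-smoothing estimate.** For a kernel `|K(u)| ≤ C/(1+u²)` there is `M` with
`|∫ K(u) (log(a² + (v−u)²) − log(1+v²)) du| ≤ M` for all `0 < a ≤ 1` and all real `v`: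
pointwise `|log(a²+(v−u)²) − log(1+v²)| ≤ 2 log 2 + log(1+u²) + max(0, −log (v−u)²)` off `u = v`,
and the right side is integrable against `|K|` uniformly in `a, v`. [folklore] -/
theorem log_smoothing {K : ℝ → ℝ} (hKc : Continuous K) {C : ℝ}
    (hKb : ∀ u, |K u| ≤ C / (1 + u ^ 2)) :
    ∃ M : ℝ, 0 ≤ M ∧ ∀ a v : ℝ, 0 < a → a ≤ 1 →
      Integrable (fun u => K u * (Real.log (a ^ 2 + (v - u) ^ 2) - Real.log (1 + v ^ 2))) ∧
      |∫ u, K u * (Real.log (a ^ 2 + (v - u) ^ 2) - Real.log (1 + v ^ 2))| ≤ M := by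
  have hCn : 0 ≤ C := by have := (abs_nonneg _).trans (hKb 0); simpa using this
  set P : ℝ → ℝ := fun x => max 0 (-Real.log (x ^ 2)) with hP
  have hPi : Integrable P := integrable_posLog
  have hP0 : ∀ x, 0 ≤ P x := fun x => le_max_left _ _
  set g₁ : ℝ → ℝ := fun u => C * (2 * Real.log 2) * (1 + u ^ 2)⁻¹ +
    C * (Real.log (1 + u ^ 2) / (1 + u ^ 2)) with hg₁
  have hg₁i : Integrable g₁ :=
    (integrable_inv_one_add_sq.const_mul _).add (integrable_log_div.const_mul C)
  have hlog2 : 0 ≤ Real.log 2 := Real.log_nonneg one_le_two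
  have hg₁0 : ∀ u, 0 ≤ g₁ u := fun u => by
    have : 0 ≤ Real.log (1 + u ^ 2) := Real.log_nonneg (by nlinarith)
    positivity
  refine ⟨(∫ u, g₁ u) + C * ∫ x, P x,
    add_nonneg (integral_nonneg hg₁0) (mul_nonneg hCn (integral_nonneg hP0)),
    fun a v ha ha1 => ?_⟩
  set D : ℝ → ℝ := fun u => Real.log (a ^ 2 + (v - u) ^ 2) - Real.log (1 + v ^ 2) with hD
  -- pointwise bound off `u = v`
  have key : ∀ u, u ≠ v → |D u| ≤ 2 * Real.log 2 + Real.log (1 + u ^ 2) + P (v - u) := by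
    intro u hu
    have hx : v - u ≠ 0 := sub_ne_zero.2 (Ne.symm hu)
    have hx2 : 0 < (v - u) ^ 2 := by positivity
    have hq : 0 < a ^ 2 + (v - u) ^ 2 := by positivity
    have hlu : 0 ≤ Real.log (1 + u ^ 2) := Real.log_nonneg (by nlinarith)
    have hPnn : 0 ≤ P (v - u) := hP0 _
    have ha2 : a ^ 2 ≤ 1 := by nlinarith
    have hup : D u ≤ Real.log 2 + Real.log (1 + u ^ 2) := by
      have h1 : a ^ 2 + (v - u) ^ 2 ≤ 2 * (1 + v ^ 2) * (1 + u ^ 2) := by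
        nlinarith [sq_nonneg (v + u), sq_nonneg v, sq_nonneg u, mul_nonneg (sq_nonneg v) (sq_nonneg u)]
      have h2 := Real.log_le_log hq h1
      rw [Real.log_mul (by positivity) (by positivity),
        Real.log_mul (by positivity) (by positivity)] at h2
      simp only [hD]; linarith
    have hlow : -D u ≤ 2 * Real.log 2 + Real.log (1 + u ^ 2) + P (v - u) := by
      have h1 : 1 + v ^ 2 ≤ 2 * (1 + (v - u) ^ 2) * (1 + u ^ 2) := by
        nlinarith [sq_nonneg (v - u - u), sq_nonneg (v - u), sq_nonneg u,
          mul_nonneg (sq_nonneg (v - u)) (sq_nonneg u)]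
      have h2 : Real.log (1 + v ^ 2) ≤
          Real.log 2 + Real.log (1 + (v - u) ^ 2) + Real.log (1 + u ^ 2) := by
        have := Real.log_le_log (by positivity) h1
        rwa [Real.log_mul (by positivity) (by positivity),
          Real.log_mul (by positivity) (by positivity)] at this
      have h3 : Real.log (1 + (v - u) ^ 2) - Real.log (a ^ 2 + (v - u) ^ 2) ≤
          Real.log 2 + P (v - u) := by
        by_cases hx1 : 1 ≤ (v - u) ^ 2
        · have h4 : 1 + (v - u) ^ 2 ≤ 2 * (a ^ 2 + (v - u) ^ 2) := by nlinarith [sq_nonneg a]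
          have h5 := Real.log_le_log (by positivity) h4
          rw [Real.log_mul (by norm_num) hq.ne'] at h5
          linarith
        · rw [not_le] at hx1
          have h4 : Real.log (1 + (v - u) ^ 2) ≤ Real.log 2 :=
            Real.log_le_log (by positivity) (by linarith)
          have h5 : -Real.log (a ^ 2 + (v - u) ^ 2) ≤ P (v - u) := by
            have h6 := Real.log_le_log hx2
              (by nlinarith [sq_nonneg a] : (v - u) ^ 2 ≤ a ^ 2 + (v - u) ^ 2)
            have : -Real.log (a ^ 2 + (v - u) ^ 2) ≤ -Real.log ((v - u) ^ 2) := by linarith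
            exact this.trans (le_max_right _ _)
          linarith
      simp only [hD]; linarith
    rw [abs_le]; constructor <;> linarith
  -- a.e. bound on the norm of the integrand
  have hbi : Integrable fun u => g₁ u + C * P (v - u) :=
    hg₁i.add ((hPi.comp_sub_left v).const_mul C)
  have hae : ∀ᵐ u ∂(volume : Measure ℝ), ‖K u * D u‖ ≤ g₁ u + C * P (v - u) := by
    have hne : ∀ᵐ u ∂(volume : Measure ℝ), u ≠ v := by
      simp [ae_iff]
    filter_upwards [hne] with u hu
    rw [Real.norm_eq_abs, abs_mul]
    have hpos : (0 : ℝ) < 1 + u ^ 2 := by positivity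
    have hk0 : 0 ≤ C / (1 + u ^ 2) := (abs_nonneg _).trans (hKb u)
    have hCle : C / (1 + u ^ 2) ≤ C := div_le_self hCn (by nlinarith)
    calc |K u| * |D u| ≤ C / (1 + u ^ 2) * (2 * Real.log 2 + Real.log (1 + u ^ 2) + P (v - u)) :=
          mul_le_mul (hKb u) (key u hu) (abs_nonneg _) hk0
      _ = g₁ u + C / (1 + u ^ 2) * P (v - u) := by
          simp only [hg₁, div_eq_mul_inv]; ring
      _ ≤ g₁ u + C * P (v - u) := by
          have := mul_le_mul_of_nonneg_right hCle (hP0 (v - u))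
          linarith
  have hDc : Continuous D := by
    have h1 : Continuous fun u : ℝ => a ^ 2 + (v - u) ^ 2 := by fun_prop
    exact (h1.log fun u => (by positivity : (0 : ℝ) < a ^ 2 + (v - u) ^ 2).ne').sub
      continuous_const
  have hint : Integrable (fun u => K u * D u) :=
    hbi.mono' (hKc.mul hDc).aestronglyMeasurable hae
  refine ⟨hint, ?_⟩
  have h := norm_integral_le_of_norm_le hbi hae
  rw [Real.norm_eq_abs] at h
  refine h.trans_eq ?_
  rw [integral_add hg₁i ((hPi.comp_sub_left v).const_mul C), integral_const_mul]
  congr 2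
  exact integral_sub_left_eq_self P volume v

/-- **Fubini step of the `W`-identity.** For `‖G(t)‖ ≤ C_g/(1+t²)²`, an even kernel
`|q(x)| ≤ AC/(1+(Ax)²)` (`0 < A ≤ 1`) and a weight `|w(s)| ≤ B + log(1+s²)`:
`∫ G(t) (∫ q(t−s) w(s) ds) dt = ∫ (∫ q(s−t) G(t) dt) w(s) ds` (the majorant
`(1+t²)⁻¹ ⊗ (B' + log(1+(As)²))/(1+(As)²)` comes from Peetre's inequality). [folklore] -/
theorem integral_mul_conv_swap {G : ℝ → ℂ} (hGc : Continuous G) {Cg : ℝ}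
    (hGb : ∀ t, ‖G t‖ ≤ Cg / (1 + t ^ 2) ^ 2) {q : ℝ → ℝ} (hqc : Continuous q) {A C : ℝ}
    (hA : 0 < A) (hA1 : A ≤ 1) (hqb : ∀ x, |q x| ≤ A * C / (1 + (A * x) ^ 2))
    (hqeven : ∀ x, q (-x) = q x) {w : ℝ → ℝ} (hwc : Continuous w) {B : ℝ}
    (hwb : ∀ s, |w s| ≤ B + Real.log (1 + s ^ 2)) :
    (∫ t, G t * ((∫ s, q (t - s) * w s : ℝ) : ℂ)) =
      ∫ s, (∫ t, (q (s - t) : ℂ) * G t) * (w s : ℂ) := by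
  have hL : ∀ t, G t * ((∫ s, q (t - s) * w s : ℝ) : ℂ) =
      ∫ s, G t * ((q (t - s) * w s : ℝ) : ℂ) := by
    intro t
    rw [← integral_complex_ofReal, ← integral_const_mul]
  have hR : ∀ s, (∫ t, (q (s - t) : ℂ) * G t) * (w s : ℂ) =
      ∫ t, G t * ((q (t - s) * w s : ℝ) : ℂ) := by
    intro s
    rw [← integral_mul_const]
    congr 1 with t
    have : q (t - s) = q (s - t) := by rw [← hqeven, neg_sub]
    rw [this]; push_cast; ring
  simp_rw [hL, hR]
  refine integral_integral_swap ?_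
  have hCg : 0 ≤ Cg := by
    have := (norm_nonneg _).trans (hGb 0); simpa using this
  have hC : 0 ≤ C := by
    have h := (abs_nonneg _).trans (hqb 0)
    simp only [mul_zero, ne_eq, OfNat.ofNat_ne_zero, not_false_eq_true, zero_pow, add_zero,
      div_one] at h
    exact (mul_nonneg_iff_of_pos_left hA).1 h
  have hBn : 0 ≤ B := by have := (abs_nonneg _).trans (hwb 0); simpa using this
  have hlA : 0 ≤ Real.log (1 / A) := Real.log_nonneg (one_le_one_div hA hA1)
  have hA2 : A ^ 2 ≤ 1 := by nlinarith
  set p : ℝ → ℝ := fun t => 2 * A * C * Cg * (1 + t ^ 2)⁻¹ with hp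
  set r : ℝ → ℝ := fun s => (B + 2 * Real.log (1 / A)) * (1 + (A * s) ^ 2)⁻¹ +
      Real.log (1 + (A * s) ^ 2) / (1 + (A * s) ^ 2) with hr
  have hpi : Integrable p := integrable_inv_one_add_sq.const_mul _
  have hri : Integrable r :=
    ((integrable_inv_one_add_sq.comp_mul_left' hA.ne').const_mul _).add
      (integrable_log_div.comp_mul_left' hA.ne')
  refine (hpi.mul_prod hri).mono' ?_ (Eventually.of_forall fun z => ?_)
  · exact (by fun_prop : Continuous fun z : ℝ × ℝ =>
      G z.1 * ((q (z.1 - z.2) * w z.2 : ℝ) : ℂ)).aestronglyMeasurable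
  · obtain ⟨t, s⟩ := z
    simp only [Function.uncurry_apply_pair]
    rw [norm_mul, Complex.norm_real, Real.norm_eq_abs, abs_mul]
    have hT : (0 : ℝ) < 1 + t ^ 2 := by positivity
    have hY : (0 : ℝ) < 1 + (A * s) ^ 2 := by positivity
    have hX : (0 : ℝ) < 1 + (A * (t - s)) ^ 2 := by positivity
    have hpeetre : (1 + (A * (t - s)) ^ 2)⁻¹ ≤ 2 * (1 + t ^ 2) * (1 + (A * s) ^ 2)⁻¹ := by
      rw [inv_eq_one_div, inv_eq_one_div, mul_one_div, div_le_div_iff₀ hX hY, one_mul]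
      nlinarith [sq_nonneg (A * (t - s) + A * t), sq_nonneg (A * t), sq_nonneg (A * (t - s)),
        sq_nonneg t, mul_nonneg (sq_nonneg t) (sq_nonneg (A * (t - s))),
        mul_le_mul_of_nonneg_right hA2 (sq_nonneg t)]
    have hlogs : Real.log (1 + s ^ 2) ≤ Real.log (1 + (A * s) ^ 2) + 2 * Real.log (1 / A) := by
      have h1 : 1 + s ^ 2 ≤ (1 + (A * s) ^ 2) / A ^ 2 := by
        rw [le_div_iff₀ (by positivity)]
        nlinarith [mul_le_mul_of_nonneg_right hA2 (sq_nonneg s)]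
      have h2 := Real.log_le_log (by positivity) h1
      rw [Real.log_div (by positivity) (by positivity), Real.log_pow] at h2
      rw [one_div, Real.log_inv]
      push_cast at h2; linarith
    have hl2 : 0 ≤ Real.log (1 + (A * s) ^ 2) := Real.log_nonneg (by nlinarith [sq_nonneg (A * s)])
    set W : ℝ := B + 2 * Real.log (1 / A) + Real.log (1 + (A * s) ^ 2) with hW
    have hW0 : 0 ≤ W := by positivity
    have h1 : ‖G t‖ ≤ Cg * (1 + t ^ 2)⁻¹ * (1 + t ^ 2)⁻¹ := by
      refine (hGb t).trans_eq ?_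
      field_simp
    have h2 : |q (t - s)| ≤ A * C * (2 * (1 + t ^ 2) * (1 + (A * s) ^ 2)⁻¹) := by
      refine (hqb _).trans ?_
      rw [div_eq_mul_inv]
      exact mul_le_mul_of_nonneg_left hpeetre (by positivity)
    have h3 : |w s| ≤ W := (hwb s).trans (by rw [hW]; linarith)
    calc ‖G t‖ * (|q (t - s)| * |w s|)
        ≤ (Cg * (1 + t ^ 2)⁻¹ * (1 + t ^ 2)⁻¹) *
            (A * C * (2 * (1 + t ^ 2) * (1 + (A * s) ^ 2)⁻¹) * W) :=
          mul_le_mul h1 (mul_le_mul h2 h3 (abs_nonneg _) (by positivity)) (by positivity)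
            (by positivity)
      _ = p t * ((1 + (A * s) ^ 2)⁻¹ * W) := by
          simp only [hp]; field_simp
      _ = p t * r s := by
          simp only [hr, hW, div_eq_mul_inv]; ring

/-- **The value of the `W`-identity.** For a Weil test `g` supported in `[-A, A]`, `A ≤ 1/2`:
`∫ ĝ(s) (θ'(s)/π + K_c(s)) ds = W(g)`, where `∫ ĝ K_c = ∫ g σ_c` reproduces the polar weight
`σ_c = e^{x/2} + e^{-x/2}` on `[-1, 1]` (so gives `ĝ(0) + ĝ(1)`), the prime term vanishes
(`A < log 2`), and `(1/π) ∫ ĝ θ' = weilArchTerm g` by `Re ψ(1/4 + it/2) = 2θ'(t) + log π` and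
`∫ ĝ = 2π g(0)`. [folklore] -/
theorem weil_value {g : ℝ → ℂ} (hg : IsWeilTest g) {A : ℝ} (hA2 : A ≤ 1 / 2)
    (hsupp : tsupport g ⊆ Icc (-A) A)
    (hGc : Continuous fun s : ℝ => weilMellin g (1 / 2 + (s : ℂ) * I)) {Cg : ℝ}
    (hGb : ∀ t : ℝ, ‖weilMellin g (1 / 2 + (t : ℂ) * I)‖ ≤ Cg / (1 + t ^ 2) ^ 2)
    {σc Kc : ℝ → ℝ} (hσc : ∀ x, |x| ≤ 1 → σc x = Real.exp (x / 2) + Real.exp (-(x / 2)))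
    (hKcc : Continuous Kc) {Cc : ℝ} (hKcb : ∀ t, |Kc t| ≤ Cc / (1 + t ^ 2))
    (hKcrep : (∫ t : ℝ, weilMellin g (1 / 2 + (t : ℂ) * I) * (Kc t : ℂ)) =
      ∫ x, g x * (σc x : ℂ))
    {w : ℝ → ℝ} (hw : ∀ s, w s = riemannSiegelThetaDeriv s / π + Kc s)
    {a : ℝ} (hwb : ∀ s, |w s| ≤ a * (1 + s ^ 2)) :
    (∫ s : ℝ, weilMellin g (1 / 2 + (s : ℂ) * I) * (w s : ℂ)) = weilFunctional g := by
  set G : ℝ → ℂ := fun s => weilMellin g (1 / 2 + (s : ℂ) * I) with hG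
  have hgc : Continuous g := hg.1.continuous
  have hCc : 0 ≤ Cc := by have := (abs_nonneg _).trans (hKcb 0); simpa using this
  have ha : 0 ≤ a := by have := (abs_nonneg _).trans (hwb 0); simpa using this
  have hθc : Continuous riemannSiegelThetaDeriv := continuous_riemannSiegelThetaDeriv_holds
  -- integrability of the pieces
  have hKcb' : ∀ t, |Kc t| ≤ Cc * (1 + t ^ 2) := fun t =>
    (hKcb t).trans ((div_le_self hCc (by nlinarith)).trans (le_mul_of_one_le_right hCc (by nlinarith)))
  have hθb : ∀ t, |riemannSiegelThetaDeriv t / π| ≤ (a + Cc) * (1 + t ^ 2) := fun t => by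
    have e : riemannSiegelThetaDeriv t / π = w t - Kc t := by rw [hw]; ring
    rw [e]
    refine (abs_sub _ _).trans ?_
    have := hwb t; have := hKcb' t
    linarith
  have hθb2 : ∀ t, |riemannSiegelThetaDeriv t| ≤ π * (a + Cc) * (1 + t ^ 2) := fun t => by
    have h := mul_le_mul_of_nonneg_left (hθb t) Real.pi_pos.le
    rwa [← abs_of_pos Real.pi_pos, ← abs_mul, abs_of_pos Real.pi_pos,
      mul_div_cancel₀ _ Real.pi_ne_zero, ← mul_assoc] at h
  have hi1 : Integrable fun t => G t * ((riemannSiegelThetaDeriv t / π : ℝ) : ℂ) :=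
    integrable_mul_of_decay hGc hGb (hθc.div_const π) hθb
  have hi2 : Integrable fun t => G t * (Kc t : ℂ) := integrable_mul_of_decay hGc hGb hKcc hKcb'
  have hi3 : Integrable fun t => G t * ((riemannSiegelThetaDeriv t : ℝ) : ℂ) :=
    integrable_mul_of_decay hGc hGb hθc hθb2
  have hi4 : Integrable fun t => G t * ((Real.log π : ℝ) : ℂ) :=
    integrable_mul_of_decay hGc hGb continuous_const (a := |Real.log π|)
      (fun t => le_mul_of_one_le_right (abs_nonneg _) (by nlinarith))
  -- split `∫ ĝ w`
  have hsplit : (∫ s, G s * (w s : ℂ)) =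
      (∫ s, G s * ((riemannSiegelThetaDeriv s / π : ℝ) : ℂ)) + ∫ s, G s * (Kc s : ℂ) := by
    rw [← integral_add hi1 hi2]
    congr 1 with s
    rw [hw]; push_cast; ring
  -- the polar term
  have hpolar : (∫ x, g x * (σc x : ℂ)) = weilPolarTerm g := by
    unfold weilPolarTerm weilMellin
    rw [← integral_add (integrable_weilIntegrand hgc hg.2 0) (integrable_weilIntegrand hgc hg.2 1)]
    congr 1 with x
    by_cases hx : g x = 0
    · simp [hx]
    · have hxs : x ∈ Icc (-A) A := hsupp (subset_tsupport g (Function.mem_support.2 hx))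
      have hx1 : |x| ≤ 1 := by
        rw [abs_le]; constructor <;> linarith [hxs.1, hxs.2]
      have e1 : cexp (((0 : ℂ) - 1 / 2) * (x : ℂ)) = ((Real.exp (-(x / 2)) : ℝ) : ℂ) := by
        rw [Complex.ofReal_exp]; congr 1; push_cast; ring
      have e2 : cexp (((1 : ℂ) - 1 / 2) * (x : ℂ)) = ((Real.exp (x / 2) : ℝ) : ℂ) := by
        rw [Complex.ofReal_exp]; congr 1; push_cast; ring
      rw [e1, e2, hσc x hx1]; push_cast; ring
  -- the archimedean term
  have hvert : (∫ y : ℝ, G y) = 2 * π * g 0 := by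
    have h := integral_weilMellin_vertical hg (1 / 2)
    push_cast at h
    exact h
  have harch : (∫ s, G s * ((riemannSiegelThetaDeriv s / π : ℝ) : ℂ)) = weilArchTerm g := by
    rw [weilArchTerm_eq]
    have hre : ∀ t : ℝ, ((Complex.digamma (1 / 4 + t / 2 * I)).re : ℂ) =
        2 * ((riemannSiegelThetaDeriv t : ℝ) : ℂ) + ((Real.log π : ℝ) : ℂ) := by
      intro t
      have : (Complex.digamma (1 / 4 + t / 2 * I)).re =
          2 * riemannSiegelThetaDeriv t + Real.log π := by
        simp only [riemannSiegelThetaDeriv]; ring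
      rw [this]; push_cast; ring
    have hI : (∫ t : ℝ, G t * ((Complex.digamma (1 / 4 + t / 2 * I)).re : ℂ)) =
        2 * (∫ t, G t * ((riemannSiegelThetaDeriv t : ℝ) : ℂ)) + (Real.log π : ℂ) * ∫ t, G t := by
      simp_rw [hre]
      have e : ∀ t, G t * (2 * ((riemannSiegelThetaDeriv t : ℝ) : ℂ) + ((Real.log π : ℝ) : ℂ)) =
          2 * (G t * ((riemannSiegelThetaDeriv t : ℝ) : ℂ)) + G t * ((Real.log π : ℝ) : ℂ) := by
        intro t; ring
      simp_rw [e]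
      rw [integral_add (hi3.const_mul 2) hi4, integral_const_mul, integral_mul_const]
      ring
    have hJ : (∫ s, G s * ((riemannSiegelThetaDeriv s / π : ℝ) : ℂ)) =
        (∫ t, G t * ((riemannSiegelThetaDeriv t : ℝ) : ℂ)) / π := by
      rw [← integral_div]
      congr 1 with s
      push_cast; ring
    rw [hJ, hI, hvert]
    have hπ : (π : ℂ) ≠ 0 := Complex.ofReal_ne_zero.2 Real.pi_ne_zero
    field_simp
    ring
  -- the prime term vanishes
  have hprime : weilPrimeTerm g = 0 := by
    refine weilPrimeTerm_eq_zero_of_tsupport_subset hgc (hsupp.trans (Icc_subset_Icc ?_ ?_))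
    · have := Real.log_two_gt_d9; linarith
    · have := Real.log_two_gt_d9; linarith
  rw [hsplit, harch, hKcrep, hpolar, weilFunctional, hprime, sub_zero, add_comm]

/-! ### Landing anchor -/

/-- **Landing anchor of this auxiliary file** (registered sub-goal `stub_density_aux2` of item
stmt-RiemannHypothesis-0187, stub `stub_density`): binder-free restatement of `log_smoothing`.
[folklore] -/
theorem stub_density_aux2 : ∀ (K : ℝ → ℝ) (C : ℝ), Continuous K → (∀ u, |K u| ≤ C / (1 + u ^ 2)) →
    ∃ M : ℝ, 0 ≤ M ∧ ∀ a v : ℝ, 0 < a → a ≤ 1 →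
      Integrable (fun u => K u * (Real.log (a ^ 2 + (v - u) ^ 2) - Real.log (1 + v ^ 2))) ∧
      |∫ u, K u * (Real.log (a ^ 2 + (v - u) ^ 2) - Real.log (1 + v ^ 2))| ≤ M :=
  fun _ _ hKc hKb => log_smoothing hKc hKb

end Density

end Summit.RiemannHypothesis.RiemannHypothesis.Theorems.SpectralThesis.Sketch

end
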